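import Summits.BirchSwinnertonDyer.BirchSwinnertonDyer.Theses.UniversalToricDescent
import Summits.BirchSwinnertonDyer.BirchSwinnertonDyer.Theses.SemiOrdinaryEisensteinDescent
import Summits.BirchSwinnertonDyer.BirchSwinnertonDyer.Theorems.SchneiderFreeAdditiveX3PoitouTateSelmerDualityHolds
import HarnessLib

set_option linter.dupNamespace false -- `…BirchSwinnertonDyer.BirchSwinnertonDyer…` is the cell's nested layout (D-0017)
set_option autoImplicit false

/-!
# Item 20461 `PoitouTateSelmerStructureDualityFact` (routes `UniversalToricDescent`, support 501; `SemiOrdinaryEisensteinDescent`,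
# r9) — Poitou–Tate duality for Selmer structures over EVERY number field — PROVED BY NAME
# (LADDER-BSD D-0154 (2), INPUTS-LIST-1 v2 DELTA-4 TRANCHE ENTRY #3)

Seat `bsd-inputs-honda-p1` (gen 6, idle INPUTS prover of the desk `pub/bsd-wall/bsd-inputs`), `--workitem`
stmt-BirchSwinnertonDyer-20461. THEOREMS ONLY (no definition, no named fact, no `sorry`).

The item is the named published fact `∀ K, Literature.NumberTheory.GaloisCohomology.poitouTate_selmerStructure_duality K`
(Milne *ADT* I Cor. 2.3 ∧ Thm. 4.10 (b) ∧ Thm. 2.6 ∧ Howard 2004 Thm. 2.1.11: for every `n ≥ 1` a family of local invariant maps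
with `IsPerfect ∧ SumLocalTermEqZero ∧ UnramifiedOrthogonal ∧ SelmerComplement`). It became a THEOREM OF THE TREE on
2026-08-28 (cell `bsd-schneider`, Route A, seats door-c4 / door-c5 / door-c6):
`Summit.BirchSwinnertonDyer.BirchSwinnertonDyer.Theorems.SchneiderFreeAdditiveX3.PoitouTateReduction.poitouTate_selmerStructure_duality_holds
(K : Type) [Field K] [NumberField K] : poitouTate_selmerStructure_duality K` (module
`Theorems.SchneiderFreeAdditiveX3PoitouTateSelmerDualityHolds`, p624636; the E-side idèle package of the presentation road —
`poitouTate_selmerStructure_duality_of_idelePackage (idelePackage_holds K)`). This leaf file only records that theorem against the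
two route declarations carrying item 20461 (one item by dedup; both are `def … : Prop :=` aliases of the item signature), by
`unfold; exact fun K _ _ => … K` — the term certified in the desk's shape file `T11-PT1DischargeShapes.lean` (plan-1 g9) with its
hypothesis `T` now discharged. Nothing is re-derived; no landed declaration is restated.

## Honest framing

An UNCONDITIONAL theorem about finite Galois modules over number fields (classical Poitou–Tate duality, 1960s; Milne *ADT* I 4.10),
kernel-checked by the `bsd-schneider` cell and merely re-typed here as the item's route declarations. Closing item 20461 makes its
consumers unconditional in this input AS TYPED only (`UniversalToricDescent` `ToricPrintedLeavesAtThree` conjunct 2 /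
`WildSplitControlAtThree`; the `SemiOrdinaryEisensteinDescent` `closes` binder; every `(hPT : ∀ K, poitouTate_selmerStructure_duality K)`
door of the wall routes). The sibling input PT2 `poitouTate_sha_tateDual` (item 20462, Milne I 4.10 (a) / Tate 1962) stays OPEN; no
crux of substance and no summit statement is proved by this file; the Birch–Swinnerton-Dyer conjecture is NOT proved by any of this.

References: [MilneADT2006] Ch. I, Cor. 2.3, Thm. 2.6, Thm. 4.10 (b) (proof, p. 58), Lemma 4.13; [Howard2004HeegnerKolyvagin]
Thm. 2.1.11; [Rubin2000] Thm. 1.7.3.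
-/

namespace Summit.BirchSwinnertonDyer.BirchSwinnertonDyer.Theorems.InputsPoitouTateSelmer

open Literature.NumberTheory.GaloisCohomology

/-- **Item 20461 on route `UniversalToricDescent` — `PoitouTateSelmerStructureDualityFact` PROVED (by name):** Poitou–Tate
duality for Selmer structures over every number field `K`, i.e. `∀ K, poitouTate_selmerStructure_duality K`, from the tree theorem
`SchneiderFreeAdditiveX3.PoitouTateReduction.poitouTate_selmerStructure_duality_holds K` (cell `bsd-schneider`, p624636).
Unconditional; closes item 20461; BSD is not proved by this. [cite: MilneADT2006, Ch. I, Thm. 4.10 (b) (proof, p. 58), Cor. 2.3,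
Thm. 2.6] [cite: Howard2004HeegnerKolyvagin, Thm. 2.1.11 (arXiv:1202.6340 p. 6)] -/
theorem universalToricDescent_poitouTateSelmerStructureDualityFact_proof :
    Summit.BirchSwinnertonDyer.BirchSwinnertonDyer.Theses.UniversalToricDescent.PoitouTateSelmerStructureDualityFact := by
  unfold Summit.BirchSwinnertonDyer.BirchSwinnertonDyer.Theses.UniversalToricDescent.PoitouTateSelmerStructureDualityFact
  exact fun K _ _ => SchneiderFreeAdditiveX3.PoitouTateReduction.poitouTate_selmerStructure_duality_holds K

/-- **Item 20461 on route `SemiOrdinaryEisensteinDescent` — the same item (one item by dedup), `PoitouTateSelmerStructureDualityFact`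
PROVED (by name):** `∀ K, poitouTate_selmerStructure_duality K` from
`SchneiderFreeAdditiveX3.PoitouTateReduction.poitouTate_selmerStructure_duality_holds`. Unconditional; BSD is not proved by this.
[cite: MilneADT2006, Ch. I, Thm. 4.10 (b) (proof, p. 58)] [cite: Howard2004HeegnerKolyvagin, Thm. 2.1.11 (arXiv:1202.6340 p. 6)] -/
theorem semiOrdinaryEisensteinDescent_poitouTateSelmerStructureDualityFact_proof :
    Summit.BirchSwinnertonDyer.BirchSwinnertonDyer.Theses.SemiOrdinaryEisensteinDescent.PoitouTateSelmerStructureDualityFact := by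
  unfold Summit.BirchSwinnertonDyer.BirchSwinnertonDyer.Theses.SemiOrdinaryEisensteinDescent.PoitouTateSelmerStructureDualityFact
  exact fun K _ _ => SchneiderFreeAdditiveX3.PoitouTateReduction.poitouTate_selmerStructure_duality_holds K

end Summit.BirchSwinnertonDyer.BirchSwinnertonDyer.Theorems.InputsPoitouTateSelmer
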